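import Mathlib.CategoryTheory.Comma.Over.Basic
import Mathlib.CategoryTheory.ObjectProperty.FullSubcategory
import Mathlib.CategoryTheory.EssentialImage
import Mathlib.CategoryTheory.IsConnected
import Literature.AlgebraicGeometry.Frobenioids.Categories
import HarnessLib

/-!
# Frobenioids I, §0: slimness, FSM-type, total epimorphicity pass to slices `C_A` and to `C[A]`

Mochizuki, *The geometry of Frobenioids I: the general theory*, Kyushu J. Math. **62** (2008),
§0 "Categories", kurims pp. 13–16 [cite: MochizukiFrdI2008, §0 pp.13-16]: the notions *slim*
(`IsSlim`, p. 14: every `C_A → C` is rigid), *of FSM-type* (`IsOfFSMType`, p. 14), *totally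
epimorphic* (`IsTotallyEpimorphic`, p. 15), *connected* (p. 16) of `Categories.lean`.

This proof-only file records the elementary inheritance facts that the corpus uses silently when it
passes from a base category `D` to a slice `D_A` ([FrdI] §0 p. 13: `C_A`) or to a category of the form
`D_A[B]` ([EtTh] §0; e.g. [EtTh] Example 3.9 (iv), PRIMS p. 311: "`D_α := (D_W)_B[α]` … the slim
[cf. Remark 3.7.2] base category `D_α` of FSM-type", where Remark 3.7.2 is the statement that
`D₀ = B^temp(X^log)⁰` itself is slim and of FSM-type):

* `IsRigidFunctor.of_comp_faithful`, `IsRigidFunctor.of_essSurj_comp` — rigidity of a functor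
  follows from rigidity of its composite with a faithful functor on the right, resp. with an
  essentially surjective functor on the left;
* `IsSlim.over`, `IsOfFSMType.over`, `IsTotallyEpimorphic.over` — `C_A` inherits each property from `C`;
* for a full subcategory cut out by a property `P` of objects that is *closed under domains of
  arrows* (`X → Y`, `P Y ⇒ P X`; the bracket construction `C[A]` = "objects admitting an arrow to `A`"
  is the case in point): `IsSlim.fullSubcategory`, `IsOfFSMType.fullSubcategory`,
  `IsTotallyEpimorphic.fullSubcategory`, and `isConnected_fullSubcategory_of_hom` (connected as soon as
  every object maps to one fixed object of the subcategory).

No statement of [FrdI] is re-typed; nothing here is specific to Frobenioids.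
-/

namespace Literature.AlgebraicGeometry.Frobenioids

open CategoryTheory

universe v v₁ v₂ v₃ u u₁ u₂ u₃

/-! ### Two reductions for rigidity of functors ([FrdI] §0 p. 14) -/

section Rigid

variable {C₁ : Type u₁} [Category.{v₁} C₁] {C₂ : Type u₂} [Category.{v₂} C₂]
  {C₃ : Type u₃} [Category.{v₃} C₃]

/-- If `F ⋙ G` is rigid and `G` is faithful, then `F` is rigid: an automorphism of `F` whiskered
with `G` is an automorphism of `F ⋙ G`, hence trivial, and `G` detects identities.
[cite: MochizukiFrdI2008, §0 p.14] -/
theorem IsRigidFunctor.of_comp_faithful {F : C₁ ⥤ C₂} {G : C₂ ⥤ C₃} [G.Faithful]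
    (h : IsRigidFunctor (F ⋙ G)) : IsRigidFunctor F := by
  intro α
  have hβ := h (Functor.isoWhiskerRight α G)
  ext X
  apply G.map_injective
  have hX : G.map (α.hom.app X) = 𝟙 (G.obj (F.obj X)) :=
    congrArg (fun i : F ⋙ G ≅ F ⋙ G => i.hom.app X) hβ
  simpa using hX

/-- If `E ⋙ F` is rigid and `E` is essentially surjective, then `F` is rigid: an automorphism of
`F` whiskered with `E` is trivial, so its components at objects in the image of `E` are identities,
and every object is isomorphic to such an object. [cite: MochizukiFrdI2008, §0 p.14] -/
theorem IsRigidFunctor.of_essSurj_comp {E : C₁ ⥤ C₂} [E.EssSurj] {F : C₂ ⥤ C₃}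
    (h : IsRigidFunctor (E ⋙ F)) : IsRigidFunctor F := by
  intro α
  have hβ := h (Functor.isoWhiskerLeft E α)
  ext Y
  have h1 : α.hom.app (E.obj (E.objPreimage Y)) = 𝟙 (F.obj (E.obj (E.objPreimage Y))) :=
    congrArg (fun i : E ⋙ F ≅ E ⋙ F => i.hom.app (E.objPreimage Y)) hβ
  have nat := α.hom.naturality (E.objObjPreimageIso Y).hom
  rw [h1, Category.id_comp] at nat
  have h2 : F.map (E.objObjPreimageIso Y).hom ≫ α.hom.app Y =
      F.map (E.objObjPreimageIso Y).hom ≫ 𝟙 _ := by rw [Category.comp_id]; exact nat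
  simpa using (cancel_epi _).mp h2

end Rigid

/-! ### Slices `C_A` ([FrdI] §0 p. 13) -/

section Slices

variable {C : Type u} [Category.{v} C]

/-- **Slices of a slim category are slim.**  For `f ∈ Ob(C_A)` the composite
`(C_A)_f → C_A → C` is, up to the equivalence `(C_A)_f ≃ C_{f.left}` (iterated slices), the rigid
functor `C_{f.left} → C`; since `C_A → C` is faithful, `(C_A)_f → C_A` is rigid.
[cite: MochizukiFrdI2008, §0 p.14] -/
theorem IsSlim.over (hC : IsSlim C) (A : C) : IsSlim (Over A) := by
  refine ⟨fun f => ?_⟩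
  have h1 : IsRigidFunctor (Over.iteratedSliceBackward f ⋙ Over.forget f ⋙ Over.forget A) := by
    rw [Over.iteratedSliceBackward_forget_forget]
    exact hC.isRigid_forget f.left
  haveI : (Over.iteratedSliceBackward f).EssSurj :=
    (inferInstance : (Over.iteratedSliceEquiv f).symm.functor.EssSurj)
  have h2 : IsRigidFunctor (Over.forget f ⋙ Over.forget A) := IsRigidFunctor.of_essSurj_comp h1
  exact IsRigidFunctor.of_comp_faithful h2

/-- An FSM-morphism of `C_A` is an FSM-morphism of `C` (the forgetful functor preserves
monomorphisms, and a test arrow `X → g.left` becomes an arrow of `C_A` by composing with the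
structure morphism of `g`). [cite: MochizukiFrdI2008, §0 p.14] -/
theorem IsFSM.left_of_over {A : C} {f g : Over A} {k : f ⟶ g} (hk : IsFSM k) : IsFSM k.left := by
  haveI : Mono k := hk.2
  refine ⟨fun X γ => ?_, inferInstance⟩
  obtain ⟨D, δB, δX, hδ⟩ := hk.1 (Over.homMk γ rfl : Over.mk (γ ≫ g.hom) ⟶ g)
  exact ⟨D.left, δB.left, δX.left, congrArg CommaMorphism.left hδ⟩

/-- **Slices of a category of FSM-type are of FSM-type**: an FSM-morphism of `C_A` is an
FSM-morphism of `C`, hence an isomorphism of `C`, hence of `C_A` (the forgetful functor reflects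
isomorphisms). [cite: MochizukiFrdI2008, §0 p.14] -/
theorem IsOfFSMType.over (hC : IsOfFSMType C) (A : C) : IsOfFSMType (Over A) := by
  refine ⟨fun k hk => ?_⟩
  haveI : IsIso ((Over.forget A).map k) := hC.isIso_of_isFSM k.left hk.left_of_over
  exact isIso_of_reflects_iso k (Over.forget A)

/-- **Slices of a totally epimorphic category are totally epimorphic** (the forgetful functor is
faithful, so it reflects epimorphisms). [cite: MochizukiFrdI2008, §0 p.15] -/
theorem IsTotallyEpimorphic.over (hC : IsTotallyEpimorphic C) (A : C) :
    IsTotallyEpimorphic (Over A) :=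
  ⟨fun k => by haveI := hC.epi k.left; exact Over.epi_of_epi_left k⟩

end Slices

/-! ### Full subcategories closed under domains of arrows (the bracket construction `C[A]`) -/

section FullSubcategories

variable {C : Type u} [Category.{v} C] {P : ObjectProperty C}

/-- **A full subcategory closed under domains of arrows of a slim category is slim**: for `X` in
the subcategory `C'`, the functor `C_{X} → (C')_X` (every object over `X` lies in `C'`) is
essentially surjective and its composite with `(C')_X → C' ↪ C` is the rigid functor `C_X → C`;
since `C' ↪ C` is faithful, `(C')_X → C'` is rigid. [cite: MochizukiFrdI2008, §0 p.14] -/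
theorem IsSlim.fullSubcategory (hC : IsSlim C) (hP : ∀ ⦃X Y : C⦄, (X ⟶ Y) → P Y → P X) :
    IsSlim P.FullSubcategory := by
  refine ⟨fun X => ?_⟩
  -- the functor `C_{X.obj} → (C')_X`
  let Φ : Over X.obj ⥤ Over X :=
    { obj := fun g =>
        Over.mk (P.homMk g.hom : (⟨g.left, hP g.hom X.property⟩ : P.FullSubcategory) ⟶ X)
      map := fun k => Over.homMk (P.homMk k.left) (by ext; exact Over.w k) }
  -- its composite with `(C')_X → C' → C` is `C_{X.obj} → C` on the nose
  have h1 : IsRigidFunctor (Φ ⋙ Over.forget X ⋙ P.ι) := hC.isRigid_forget X.obj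
  haveI : Φ.EssSurj :=
    ⟨fun Y => ⟨Over.mk Y.hom.hom,
      ⟨Over.isoMk (Iso.refl _) (by ext; exact Category.id_comp _)⟩⟩⟩
  have h2 : IsRigidFunctor (Over.forget X ⋙ P.ι) := IsRigidFunctor.of_essSurj_comp h1
  exact IsRigidFunctor.of_comp_faithful h2

/-- An FSM-morphism of a full subcategory closed under domains of arrows is an FSM-morphism of `C`
(test objects mapping into the subcategory lie in it). [cite: MochizukiFrdI2008, §0 p.14] -/
theorem IsFSM.hom_of_fullSubcategory (hP : ∀ ⦃X Y : C⦄, (X ⟶ Y) → P Y → P X)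
    {Y Z : P.FullSubcategory} {k : Y ⟶ Z} (hk : IsFSM k) : IsFSM k.hom := by
  haveI : Mono k := hk.2
  refine ⟨fun X γ => ?_, ⟨fun {W} g h hgh => ?_⟩⟩
  · obtain ⟨D, δB, δX, hδ⟩ :=
      hk.1 (P.homMk γ : (⟨X, hP γ Z.property⟩ : P.FullSubcategory) ⟶ Z)
    exact ⟨D.obj, δB.hom, δX.hom, by simpa using congrArg InducedCategory.Hom.hom hδ⟩
  · have h' : (P.homMk g : (⟨W, hP g Y.property⟩ : P.FullSubcategory) ⟶ Y) ≫ k =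
        (P.homMk h : (⟨W, hP g Y.property⟩ : P.FullSubcategory) ⟶ Y) ≫ k := by
      ext; simpa using hgh
    have := (cancel_mono k).mp h'
    simpa using congrArg InducedCategory.Hom.hom this

/-- **A full subcategory closed under domains of arrows of a category of FSM-type is of FSM-type.**
[cite: MochizukiFrdI2008, §0 p.14] -/
theorem IsOfFSMType.fullSubcategory (hC : IsOfFSMType C)
    (hP : ∀ ⦃X Y : C⦄, (X ⟶ Y) → P Y → P X) :
    IsOfFSMType P.FullSubcategory := by
  refine ⟨fun k hk => ?_⟩
  haveI : IsIso k.hom := hC.isIso_of_isFSM k.hom (hk.hom_of_fullSubcategory hP)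
  exact (P.isIso_hom_iff k).mp inferInstance

/-- **A full subcategory of a totally epimorphic category is totally epimorphic** (no closure
hypothesis needed: the inclusion is faithful). [cite: MochizukiFrdI2008, §0 p.15] -/
theorem IsTotallyEpimorphic.fullSubcategory (hC : IsTotallyEpimorphic C) (P : ObjectProperty C) :
    IsTotallyEpimorphic P.FullSubcategory :=
  ⟨fun k => P.ι.epi_of_epi_map (show Epi (P.ι.map k) from hC.epi k.hom)⟩

/-- A full subcategory containing an object `T` to which each of its objects admits an arrow is
connected ([FrdI] §0 p. 16: the graph of the category is connected — every vertex is joined to `T`).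
[cite: MochizukiFrdI2008, §0 p.16] -/
theorem isConnected_fullSubcategory_of_hom {T : C} (hT : P T)
    (h : ∀ X : C, P X → Nonempty (X ⟶ T)) : IsConnected P.FullSubcategory := by
  haveI : Nonempty P.FullSubcategory := ⟨⟨T, hT⟩⟩
  refine zigzag_isConnected fun X Y => ?_
  obtain ⟨f⟩ := h X.obj X.property
  obtain ⟨g⟩ := h Y.obj Y.property
  exact (Zigzag.of_hom (P.homMk f : X ⟶ ⟨T, hT⟩)).trans
    (Zigzag.of_inv (P.homMk g : Y ⟶ ⟨T, hT⟩))

end FullSubcategories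

end Literature.AlgebraicGeometry.Frobenioids
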